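import Literature.AlgebraicGeometry.Frobenioids.PerfFactorialSupports
import HarnessLib

/-!
# Frobenioids I, Proposition 4.1 (iii) / Definition 2.4 (i): elements with disjoint supports are
# determined by their difference

Mochizuki, *The geometry of Frobenioids I: the general theory*, Kyushu J. Math. **62** (2008),
Definition 2.4 (i)(c)(d) (kurims pp. 47–48) and Proposition 4.1 (iii) (pp. 76–77)
[cite: MochizukiFrdI2008, Prop. 4.1 (iii) p.76]; used in [EtTh] Definition 4.1 (i), PDF p.86:
"`Div(s')`, `Div(s'')` have disjoint supports [cf. [FrdI], Proposition 4.1, (iii)]. [Thus, `Div(s')`,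
`Div(s'')` are uniquely determined by `f`.]"

In a perfect perf-factorial monoid `M` (written multiplicatively as in `Monoids.lean`): if `(a, b)` and
`(a', b')` are pairs WITH DISJOINT SUPPORTS — in the divisibility form of Prop. 4.1 (iii), "every `x`
with `x ≤ a`, `x ≤ b` is `0`" (`PerfFactorialSupports.lean`,
`IsPerfFactorial.forall_common_dvd_eq_one_iff_disjoint_supp`) — and `a + b' = a' + b` (i.e. the
"differences" `a − b`, `a' − b'` agree in `M^gp`), then `a = a'` and `b = b'`: compare the primary
factorizations coordinatewise in `∏_𝔮 M^rlf_𝔮`, each factor being sharp.  This is the monoid content of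
the bracket of [EtTh] Def. 4.1 (i) (abc-iut cell, ROW `EtTh:Prop4.2`, seat abc-iut-L6-t12).
No new definitions.
-/

namespace Literature.AlgebraicGeometry.Frobenioids

open Function

universe u

variable {M : Type u} [CommMonoid M]

/-- Pointwise step: in a sharp commutative monoid, if `x = 1 ∨ y = 1`, `x' = 1 ∨ y' = 1` and
`x · y' = x' · y`, then `x = x'` and `y = y'`. [cite: MochizukiFrdI2008, Prop. 4.1 (iii) p.77] -/
theorem eq_and_eq_of_mul_eq_mul_of_sharp {N : Type u} [CommMonoid N] (hN : IsSharp N) {x y x' y' : N}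
    (h1 : x = 1 ∨ y = 1) (h2 : x' = 1 ∨ y' = 1) (e : x * y' = x' * y) : x = x' ∧ y = y' := by
  rcases h1 with hx | hy <;> rcases h2 with hx' | hy'
  · rw [hx, hx', one_mul, one_mul] at e
    exact ⟨hx.trans hx'.symm, e.symm⟩
  · rw [hx, hy', one_mul] at e
    have hx'1 : x' = 1 := hN.1 _ (IsUnit.of_mul_eq_one _ e.symm)
    have hy1 : y = 1 := hN.1 _ (IsUnit.of_mul_eq_one_right _ e.symm)
    exact ⟨hx.trans hx'1.symm, hy1.trans hy'.symm⟩
  · rw [hy, hx', mul_one] at e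
    have hx1 : x = 1 := hN.1 _ (IsUnit.of_mul_eq_one _ e)
    have hy'1 : y' = 1 := hN.1 _ (IsUnit.of_mul_eq_one_right _ e)
    exact ⟨hx1.trans hx'.symm, hy.trans hy'1.symm⟩
  · rw [hy, hy', mul_one, mul_one] at e
    exact ⟨e, hy.trans hy'.symm⟩

/-- **[FrdI] Prop. 4.1 (iii) / [EtTh] Def. 4.1 (i), "[Thus, `Div(s')`, `Div(s'')` are uniquely determined
by `f`.]"**: in a perfect perf-factorial monoid, two pairs `(a, b)`, `(a', b')` with disjoint supports
(no non-trivial common divisor) and `a · b' = a' · b` coincide: `a = a'`, `b = b'` (coordinatewise in the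
factorization `M ≅ M^pf ↪ ∏_𝔮 M^rlf_𝔮`, Def. 2.4 (i)(c), each `M^rlf_𝔮` sharp).
[cite: MochizukiFrdI2008, Prop. 4.1 (iii) p.76] -/
theorem IsPerfFactorial.eq_of_mul_eq_mul_of_forall_common_dvd_eq_one (h : IsPerfFactorial M)
    (hperf : IsPerfect M) {a b a' b' : M} (hab : ∀ x : M, x ∣ a → x ∣ b → x = 1)
    (hab' : ∀ x : M, x ∣ a' → x ∣ b' → x = 1) (e : a * b' = a' * b) : a = a' ∧ b = b' := by
  have hbij := isPerfect_iff_bijective_of.mp hperf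
  have hd := (h.forall_common_dvd_eq_one_iff_disjoint_supp hperf a b).mp hab
  have hd' := (h.forall_common_dvd_eq_one_iff_disjoint_supp hperf a' b').mp hab'
  have eF : factorMap M (Perfection.of M a) * factorMap M (Perfection.of M b') =
      factorMap M (Perfection.of M a') * factorMap M (Perfection.of M b) := by
    rw [← h.factorMap_mul, ← h.factorMap_mul, ← map_mul, ← map_mul, e]
  have key : ∀ 𝔮, factorMap M (Perfection.of M a) 𝔮 = factorMap M (Perfection.of M a') 𝔮 ∧
      factorMap M (Perfection.of M b) 𝔮 = factorMap M (Perfection.of M b') 𝔮 := by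
    intro 𝔮
    have e𝔮 := congrFun eF 𝔮
    rw [Pi.mul_apply, Pi.mul_apply] at e𝔮
    have h1 : factorMap M (Perfection.of M a) 𝔮 = 1 ∨ factorMap M (Perfection.of M b) 𝔮 = 1 := by
      by_cases hx : factorMap M (Perfection.of M a) 𝔮 = 1
      · exact Or.inl hx
      · exact Or.inr (of_not_not (Set.disjoint_left.mp hd hx))
    have h2 : factorMap M (Perfection.of M a') 𝔮 = 1 ∨ factorMap M (Perfection.of M b') 𝔮 = 1 := by
      by_cases hx : factorMap M (Perfection.of M a') 𝔮 = 1
      · exact Or.inl hx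
      · exact Or.inr (of_not_not (Set.disjoint_left.mp hd' hx))
    exact eq_and_eq_of_mul_eq_mul_of_sharp (isSharp_realification _) h1 h2 e𝔮
  have ha : factorMap M (Perfection.of M a) = factorMap M (Perfection.of M a') :=
    funext fun 𝔮 => (key 𝔮).1
  have hb : factorMap M (Perfection.of M b) = factorMap M (Perfection.of M b') :=
    funext fun 𝔮 => (key 𝔮).2
  exact ⟨hbij.1 (h.factorMap_injective ha), hbij.1 (h.factorMap_injective hb)⟩

/-- The "no non-trivial common divisor" form of disjoint supports is transported by any multiplicative
equivalence (e.g. pull-back along an isomorphism of the base category). [cite: MochizukiFrdI2008, Prop. 4.1 (iii) p.76] -/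
theorem forall_common_dvd_eq_one_map_mulEquiv {N : Type*} [CommMonoid N] (φ : M ≃* N) {a b : M}
    (hab : ∀ x : M, x ∣ a → x ∣ b → x = 1) : ∀ y : N, y ∣ φ a → y ∣ φ b → y = 1 := by
  intro y hya hyb
  have h1 : φ.symm y ∣ a := by simpa using map_dvd φ.symm hya
  have h2 : φ.symm y ∣ b := by simpa using map_dvd φ.symm hyb
  have h3 := hab _ h1 h2
  simpa using congrArg φ h3

end Literature.AlgebraicGeometry.Frobenioids
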